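import Mathlib.Analysis.SpecialFunctions.Pow.Real
import Mathlib.LinearAlgebra.Matrix.PosDef
import Mathlib.MeasureTheory.Measure.Haar.NormedSpace
import Mathlib.MeasureTheory.Measure.Lebesgue.EqHaar
import Literature.Analysis.FluidPDE.WholeSpaceIBP
import HarnessLib

/-!
# Dilation covariance of the weak stationary Euler–Reynolds system

Analysis/FluidPDE support file (everything proved; no definitions, no named facts). The
stationary Euler–Reynolds system `div (U ⊗ U + R) + ∇p = 0`, `div U = 0` on `ℝᵈ` is invariant
under the two-parameter family of dilations `U ↦ a U(μ ·)`, `R ↦ a² R(μ ·)`, `p ↦ a² p(μ ·)`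
(`μ > 0`): this is the scaling used to shrink a given (sub)solution into a small ball before
planting it in a periodic box (De Lellis–Székelyhidi 2010, §2, subsolutions; the Navier–Stokes
case with `a = μ` is Leray's scaling, cf. the tree's `IsClassicalNSSolutionOn.stRescale`). This
file proves the covariance for the WEAK, pressure-free formulation against divergence-free test
fields, together with the bookkeeping facts needed to transport a whole "sink completion" (a weak
subsolution on `ℝ³ ∖ {0}` glued from a rough germ and a smooth collar) along a dilation:

* `integral_inner_smul_comp_smul_gradient_eq_zero` — weak divergence-freeness is dilation
  covariant (`∫ ⟪a U(μ ·), ∇θ⟫ = a μ^{1-d} ∫ ⟪U, ∇θ(μ⁻¹ ·)⟫`);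
* `integrableOn_comp_smul_ball` (and a private `Lᵖ` twin of the tree's `memLp_comp_smul`) —
  local integrability under dilations (Mathlib's `Measure.map_addHaar_smul`,
  `integrable_comp_smul_iff`);
* `posDef_of_mul` — positive definiteness survives positive scalar factors;
* `integral_eulerReynolds_comp_smul_eq_zero` (`ℝ³`, coordinates) — the weak identity
  `∫ (⟪U, Dw·U⟫ + Σᵢⱼ Rᵢⱼ ∂ⱼwᵢ) = 0` for all divergence-free `w ∈ C_c^∞(ℝ³ ∖ {0})` passes to
  `(a U(μ ·), a² R(μ ·))` (test `w(μ⁻¹ ·)`, change of variables `Measure.integral_comp_smul`);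
* `sinkCompletion_rescale` (`ℝ³`) — the full clause list of a free-space sink completion of a
  discretely self-similar germ `V` (`V(λ x) = λ^{-2/3} V x`) is reproduced by the dilation with
  `μ = λ^m`, `a = μ^{2/3}`, with radii `r/μ` and ambient level `c μ^{4/3}`; the germ itself is
  unchanged (`apply_pow_smul_of_dss`).

## Mathlib / tree search

Mathlib: `fderiv_comp_smul`, `Measure.integral_comp_smul`, `Measure.map_addHaar_smul`,
`integrable_comp_smul_iff`, `HasCompactSupport.comp_smul`, `Matrix.PosDef.smul`. Tree: the
classical (space–time) rescaling `IsClassicalNSSolutionOn.stRescale` (`ClassicalSolutionRescale`);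
nothing for the weak stationary Euler–Reynolds pairing (`lean search 'comp_smul.*Reynolds|
eulerReynolds'`).

## References

* C. De Lellis, L. Székelyhidi Jr., *On admissibility criteria for weak solutions of the Euler
  equations*, Arch. Ration. Mech. Anal. 195 (2010), §2.
* J. Leray, *Sur le mouvement d'un liquide visqueux emplissant l'espace*, Acta Math. 63 (1934),
  §20 (the scaling).
-/

noncomputable section

open MeasureTheory Set Function Filter Metric TopologicalSpace
open scoped RealInnerProductSpace ContDiff Topology ENNReal

namespace Literature.Analysis.FluidPDE

section General

variable {E : Type*} [NormedAddCommGroup E] [InnerProductSpace ℝ E] [FiniteDimensional ℝ E]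
  [MeasurableSpace E] [BorelSpace E]
variable {F : Type*} [NormedAddCommGroup F]

omit [MeasurableSpace E] [BorelSpace E] in
/-- Chain rule for the gradient under a dilation: `∇(θ(μ ·))(x) = μ ∇θ(μ x)` (no
differentiability needed, as for Mathlib's `fderiv_comp_smul`); private copy of the tree's
`gradient_comp_smul` (`FlatSwirlGauge`, not imported to keep the import graph light). [folklore] -/
private theorem gradient_comp_smul_aux (θ : E → ℝ) (μ : ℝ) (x : E) :
    gradient (fun y => θ (μ • y)) x = μ • gradient θ (μ • x) := by
  haveI : CompleteSpace E := FiniteDimensional.complete ℝ E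
  rw [gradient, gradient, fderiv_comp_smul μ, map_smulₛₗ]
  simp

/-- **Weak divergence-freeness is dilation covariant.** If `∫ ⟪U, ∇θ⟫ = 0` for all smooth
compactly supported `θ`, then the same holds for `x ↦ a U(μ x)` (`μ ≠ 0`): test with
`θ(μ⁻¹ ·)` and change variables. [folklore] -/
theorem integral_inner_smul_comp_smul_gradient_eq_zero {U : E → E}
    (hU : ∀ θ : E → ℝ, ContDiff ℝ ∞ θ → HasCompactSupport θ → ∫ x, ⟪U x, gradient θ x⟫ = 0)
    (a : ℝ) {μ : ℝ} (hμ : μ ≠ 0) (θ : E → ℝ) (hθ : ContDiff ℝ ∞ θ)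
    (hθc : HasCompactSupport θ) : ∫ x, ⟪a • U (μ • x), gradient θ x⟫ = 0 := by
  set θ' : E → ℝ := fun y => θ (μ⁻¹ • y) with hθ'
  have hθ_eq : θ = fun x => θ' (μ • x) := funext fun x => by simp [hθ', inv_smul_smul₀ hμ]
  have hθ's : ContDiff ℝ ∞ θ' := hθ.comp (contDiff_const_smul _)
  have hθ'c : HasCompactSupport θ' := hθc.comp_smul (inv_ne_zero hμ)
  have hG : ∀ x, gradient θ x = μ • gradient θ' (μ • x) := fun x => by
    rw [hθ_eq]
    exact gradient_comp_smul_aux θ' μ x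
  have hpt : ∀ x, ⟪a • U (μ • x), gradient θ x⟫ =
      (a * μ) * ⟪U (μ • x), gradient θ' (μ • x)⟫ := fun x => by
    rw [hG x, real_inner_smul_left, real_inner_smul_right]
    ring
  simp_rw [hpt]
  have hcv := Measure.integral_comp_smul volume (fun y => ⟪U y, gradient θ' y⟫) μ
  rw [integral_const_mul, hcv, hU θ' hθ's hθ'c, smul_zero, mul_zero]

/-- **`Lᵖ` under dilations**: if `f ∈ Lᵖ(E)` then `f(μ ·) ∈ Lᵖ(E)` for `μ ≠ 0` (the image of
Lebesgue measure under `x ↦ μ x` is `|μ|^{-d}` times Lebesgue measure); private copy of the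
tree's `memLp_comp_smul` (`NecasRuzickaSverakRRS`, not imported here). [folklore] -/
private theorem memLp_comp_smul_aux {f : E → F} {p : ℝ≥0∞} (hf : MemLp f p volume) {μ : ℝ} (hμ : μ ≠ 0) :
    MemLp (fun x => f (μ • x)) p volume := by
  have hmap : Measure.map (fun x : E => μ • x) volume =
      ENNReal.ofReal (abs (μ ^ Module.finrank ℝ E)⁻¹) • (volume : Measure E) :=
    Measure.map_addHaar_smul volume hμ
  have h1 : MemLp f p (Measure.map (fun x : E => μ • x) volume) := by
    rw [hmap]
    exact hf.smul_measure ENNReal.ofReal_ne_top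
  exact (memLp_map_measure_iff h1.aestronglyMeasurable (measurable_const_smul μ).aemeasurable).1 h1

omit [InnerProductSpace ℝ E] [FiniteDimensional ℝ E] [MeasurableSpace E] [BorelSpace E] in
/-- The preimage of a centred ball under the dilation `x ↦ μ x`, `μ > 0` (private helper; a
differently normalised twin is `preimage_smul_ball_zero` of `NSLerayHopfSereginProfileProofs`).
[folklore] -/
private theorem preimage_smul_ball_zero_aux [NormedSpace ℝ E] {μ : ℝ} (hμ : 0 < μ) (r : ℝ) :
    (fun x : E => μ • x) ⁻¹' ball 0 r = ball 0 (r / μ) := by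
  ext x
  simp only [mem_preimage, mem_ball_zero_iff, norm_smul, Real.norm_eq_abs, abs_of_pos hμ,
    lt_div_iff₀ hμ, mul_comm]

/-- **Local integrability under dilations**: `R ∈ L¹(B_r)` implies `R(μ ·) ∈ L¹(B_{r/μ})` for
`μ > 0`. [folklore] -/
theorem integrableOn_comp_smul_ball {R : E → F} {r : ℝ} (hR : IntegrableOn R (ball 0 r) volume)
    {μ : ℝ} (hμ : 0 < μ) : IntegrableOn (fun x => R (μ • x)) (ball 0 (r / μ)) volume := by
  rw [← integrable_indicator_iff measurableSet_ball] at hR ⊢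
  rw [← preimage_smul_ball_zero_aux hμ r]
  have heq : ((fun x : E => μ • x) ⁻¹' ball 0 r).indicator (fun x => R (μ • x)) =
      fun x => (ball 0 r).indicator R (μ • x) :=
    funext fun x => indicator_comp_right (fun x : E => μ • x) (g := R)
  rw [heq]
  exact (integrable_comp_smul_iff volume ((ball 0 r).indicator R) hμ.ne').2 hR

end General

/-- Positive definiteness survives multiplication of all entries by a positive scalar. [folklore] -/
theorem posDef_of_mul {ι : Type*} [Fintype ι] {R : ι → ι → ℝ} (h : (Matrix.of R).PosDef) {k : ℝ}
    (hk : 0 < k) : (Matrix.of fun i j => k * R i j).PosDef := by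
  have : (Matrix.of fun i j => k * R i j) = k • Matrix.of R := by
    ext i j
    simp
  rw [this]
  exact h.smul hk

/-! ### The weak Euler–Reynolds pairing on `ℝ³` -/

section R3

/-- **Dilation covariance of the weak stationary Euler–Reynolds system on `ℝ³ ∖ {0}`.** If
`∫ (⟪U, Dw·U⟫ + Σᵢⱼ Rᵢⱼ (Dw eⱼ)ᵢ) = 0` for every smooth divergence-free `w` compactly
supported off the origin, then the dilated pair `(a U(μ ·), a² R(μ ·))` (`μ > 0`) satisfies the
same identity: test with `w(μ⁻¹ ·)` (again smooth, divergence free, compactly supported off the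
origin), use `Dw(x) = μ D(w(μ⁻¹ ·))(μ x)`, and change variables
(`Measure.integral_comp_smul`). Coordinates: `(Dw eⱼ)ᵢ` with `eⱼ = EuclideanSpace.single j 1`.
[folklore] -/
theorem integral_eulerReynolds_comp_smul_eq_zero {U : EuclideanSpace ℝ (Fin 3) → EuclideanSpace ℝ (Fin 3)}
    {R : EuclideanSpace ℝ (Fin 3) → Fin 3 → Fin 3 → ℝ}
    (h : ∀ w : EuclideanSpace ℝ (Fin 3) → EuclideanSpace ℝ (Fin 3),
      FunctionSpaces.IsTestFunctionOn ⟨{x : EuclideanSpace ℝ (Fin 3) | x ≠ 0}, isOpen_ne⟩ w →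
      (∀ x, VectorCalculus.divergence w x = 0) →
      ∫ x, (⟪U x, fderiv ℝ w x (U x)⟫ +
        ∑ i, ∑ j, R x i j * fderiv ℝ w x (EuclideanSpace.single j 1) i) = 0)
    (a k : ℝ) (hk : a ^ 2 = k) {μ : ℝ} (hμ : 0 < μ)
    (w : EuclideanSpace ℝ (Fin 3) → EuclideanSpace ℝ (Fin 3))
    (hw : FunctionSpaces.IsTestFunctionOn ⟨{x : EuclideanSpace ℝ (Fin 3) | x ≠ 0}, isOpen_ne⟩ w)
    (hdiv : ∀ x, VectorCalculus.divergence w x = 0) :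
    ∫ x, (⟪a • U (μ • x), fderiv ℝ w x (a • U (μ • x))⟫ +
      ∑ i, ∑ j, (k * R (μ • x) i j) * fderiv ℝ w x (EuclideanSpace.single j 1) i) = 0 := by
  have hμ0 : μ ≠ 0 := hμ.ne'
  -- the rescaled test field
  set w' : EuclideanSpace ℝ (Fin 3) → EuclideanSpace ℝ (Fin 3) := fun y => w (μ⁻¹ • y) with hw'
  have hw_eq : w = fun x => w' (μ • x) := funext fun x => by simp [hw', inv_smul_smul₀ hμ0]
  have hw's : ContDiff ℝ ∞ w' := hw.contDiff.comp (contDiff_const_smul _)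
  have hw'c : HasCompactSupport w' := hw.hasCompactSupport.comp_smul (inv_ne_zero hμ0)
  have hw'0 : (0 : EuclideanSpace ℝ (Fin 3)) ∉ tsupport w' := by
    have h0 : (0 : EuclideanSpace ℝ (Fin 3)) ∉ tsupport w := fun h0 => by
      simpa using hw.tsupport_subset h0
    rw [notMem_tsupport_iff_eventuallyEq] at h0 ⊢
    have ht : Tendsto (fun y : EuclideanSpace ℝ (Fin 3) => μ⁻¹ • y) (𝓝 0) (𝓝 0) := by
      simpa using (continuous_const_smul μ⁻¹).tendsto (0 : EuclideanSpace ℝ (Fin 3))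
    exact ht.eventually h0
  have hw't : FunctionSpaces.IsTestFunctionOn
      ⟨{x : EuclideanSpace ℝ (Fin 3) | x ≠ 0}, isOpen_ne⟩ w' :=
    ⟨hw's, hw'c, fun x hx => by
      rintro rfl
      exact hw'0 hx⟩
  have hD : ∀ x, fderiv ℝ w x = μ • fderiv ℝ w' (μ • x) := fun x => by
    rw [hw_eq]
    exact fderiv_comp_smul μ
  have hdiv' : ∀ y, VectorCalculus.divergence w' y = 0 := fun y => by
    have h1 : fderiv ℝ w' y = μ⁻¹ • fderiv ℝ w (μ⁻¹ • y) := fderiv_comp_smul μ⁻¹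
    have h2 := hdiv (μ⁻¹ • y)
    unfold VectorCalculus.divergence at h2 ⊢
    rw [h1, ContinuousLinearMap.toLinearMap_smul, map_smul, h2, smul_zero]
  -- the dilated integrand is `a² μ` times the original integrand for `w'`, read at `μ x`
  have key := h w' hw't hdiv'
  have hpt : ∀ x, ⟪a • U (μ • x), fderiv ℝ w x (a • U (μ • x))⟫ +
      ∑ i, ∑ j, (k * R (μ • x) i j) * fderiv ℝ w x (EuclideanSpace.single j 1) i =
      (a ^ 2 * μ) * (⟪U (μ • x), fderiv ℝ w' (μ • x) (U (μ • x))⟫ +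
        ∑ i, ∑ j, R (μ • x) i j * fderiv ℝ w' (μ • x) (EuclideanSpace.single j 1) i) := by
    intro x
    rw [hD x]
    have e1 : ⟪a • U (μ • x), (μ • fderiv ℝ w' (μ • x)) (a • U (μ • x))⟫ =
        (a ^ 2 * μ) * ⟪U (μ • x), fderiv ℝ w' (μ • x) (U (μ • x))⟫ := by
      rw [_root_.smul_apply, map_smul, real_inner_smul_left, real_inner_smul_right,
        real_inner_smul_right]
      ring
    have e2 : ∀ i j, (k * R (μ • x) i j) *
        (μ • fderiv ℝ w' (μ • x)) (EuclideanSpace.single j 1) i =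
        (a ^ 2 * μ) * (R (μ • x) i j * fderiv ℝ w' (μ • x) (EuclideanSpace.single j 1) i) := by
      intro i j
      rw [_root_.smul_apply, PiLp.smul_apply, smul_eq_mul, ← hk]
      ring
    simp_rw [e2, ← Finset.mul_sum]
    rw [e1]
    ring
  simp_rw [hpt]
  have hcv := Measure.integral_comp_smul volume
    (fun y => ⟪U y, fderiv ℝ w' y (U y)⟫ +
      ∑ i, ∑ j, R y i j * fderiv ℝ w' y (EuclideanSpace.single j 1) i) μ
  rw [integral_const_mul, hcv, key, smul_zero, mul_zero]

/-- Iterated discrete self-similarity: if `V (λ x) = λ^{-2/3} V x` off the origin (`λ > 0`), then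
`V (λ^m x) = (λ^m)^{-2/3} V x` off the origin, for every `m : ℕ`. [folklore] -/
theorem apply_pow_smul_of_dss {V : EuclideanSpace ℝ (Fin 3) → EuclideanSpace ℝ (Fin 3)} {lam : ℝ}
    (hlam : 0 < lam) (hDSS : ∀ x, x ≠ 0 → V (lam • x) = lam ^ (-(2 / 3 : ℝ)) • V x) (m : ℕ)
    (x : EuclideanSpace ℝ (Fin 3)) (hx : x ≠ 0) :
    V (lam ^ m • x) = (lam ^ m) ^ (-(2 / 3 : ℝ)) • V x := by
  induction m with
  | zero => simp
  | succ k ih =>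
    have hkx : lam ^ k • x ≠ 0 := smul_ne_zero (pow_ne_zero k hlam.ne') hx
    rw [pow_succ', mul_smul, hDSS _ hkx, ih, smul_smul, Real.mul_rpow hlam.le (pow_nonneg hlam.le k)]

/-- **A free-space sink completion is reproduced at every smaller scale.** Let `V` be discretely
self-similar, `V(λ x) = λ^{-2/3} V(x)` off the origin (`λ > 1`), and let `(r₀, r₁, c, U, R)` be a
sink completion of the germ `V` on `ℝ³`: `U = V` on `0 < |x| < r₀`, `R = 0` on `|x| ≤ r₀`, rest
state `(0, c·Id)` on `|x| ≥ r₁`, `U, R` smooth and `R ≻ 0` on `|x| > r₀`, `U ∈ L²`, `R ∈ L¹(B_{r₁})`,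
`U` weakly divergence free, and `(U, R)` a weak Euler–Reynolds subsolution against divergence-free
tests compactly supported off the origin. Then for every `m : ℕ`, with `μ = λ^m`, the dilated
data `(r₀/μ, r₁/μ, c μ^{4/3}, μ^{2/3} U(μ ·), μ^{4/3} R(μ ·))` is again a sink completion of the
SAME germ `V` (the germ is fixed by self-similarity; all other clauses are dilation covariant:
`integral_inner_smul_comp_smul_gradient_eq_zero`, `integrableOn_comp_smul_ball`,
`integral_eulerReynolds_comp_smul_eq_zero`). [folklore] -/
theorem sinkCompletion_rescale (lam : ℝ) (V : EuclideanSpace ℝ (Fin 3) → EuclideanSpace ℝ (Fin 3))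
    (hlam : 1 < lam)
    (hDSS : ∀ x : EuclideanSpace ℝ (Fin 3), x ≠ 0 → V (lam • x) = lam ^ (-(2 / 3 : ℝ)) • V x)
    (r₀ r₁ c : ℝ) (U : EuclideanSpace ℝ (Fin 3) → EuclideanSpace ℝ (Fin 3))
    (R : EuclideanSpace ℝ (Fin 3) → Fin 3 → Fin 3 → ℝ)
    (hr : 0 < r₀ ∧ r₀ < r₁ ∧ 0 < c)
    (hgerm : ∀ x : EuclideanSpace ℝ (Fin 3), 0 < ‖x‖ → ‖x‖ < r₀ → U x = V x)
    (hR0 : ∀ x : EuclideanSpace ℝ (Fin 3), ‖x‖ ≤ r₀ → R x = 0)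
    (hrest : ∀ x : EuclideanSpace ℝ (Fin 3), r₁ ≤ ‖x‖ →
      U x = 0 ∧ R x = fun i j => if i = j then c else 0)
    (hUs : ContDiffOn ℝ ∞ U {x : EuclideanSpace ℝ (Fin 3) | r₀ < ‖x‖})
    (hRs : ContDiffOn ℝ ∞ R {x : EuclideanSpace ℝ (Fin 3) | r₀ < ‖x‖})
    (hpos : ∀ x : EuclideanSpace ℝ (Fin 3), r₀ < ‖x‖ → (Matrix.of (R x)).PosDef)
    (hint : MemLp U 2 volume ∧ IntegrableOn R (ball (0 : EuclideanSpace ℝ (Fin 3)) r₁) volume)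
    (hwdiv : ∀ θ : EuclideanSpace ℝ (Fin 3) → ℝ, ContDiff ℝ ∞ θ → HasCompactSupport θ →
      ∫ x, ⟪U x, gradient θ x⟫ = 0)
    (hweak : ∀ w : EuclideanSpace ℝ (Fin 3) → EuclideanSpace ℝ (Fin 3),
      FunctionSpaces.IsTestFunctionOn ⟨{x : EuclideanSpace ℝ (Fin 3) | x ≠ 0}, isOpen_ne⟩ w →
      (∀ x, VectorCalculus.divergence w x = 0) →
      ∫ x, (⟪U x, fderiv ℝ w x (U x)⟫ +
        ∑ i, ∑ j, R x i j * fderiv ℝ w x (EuclideanSpace.single j 1) i) = 0)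
    (m : ℕ) :
    (0 < r₀ / lam ^ m ∧ r₀ / lam ^ m < r₁ / lam ^ m ∧ 0 < c * (lam ^ m) ^ (4 / 3 : ℝ)) ∧
    (∀ x : EuclideanSpace ℝ (Fin 3), 0 < ‖x‖ → ‖x‖ < r₀ / lam ^ m →
      (lam ^ m) ^ (2 / 3 : ℝ) • U (lam ^ m • x) = V x) ∧
    (∀ x : EuclideanSpace ℝ (Fin 3), ‖x‖ ≤ r₀ / lam ^ m →
      (fun i j => (lam ^ m) ^ (4 / 3 : ℝ) * R (lam ^ m • x) i j) = 0) ∧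
    (∀ x : EuclideanSpace ℝ (Fin 3), r₁ / lam ^ m ≤ ‖x‖ →
      (lam ^ m) ^ (2 / 3 : ℝ) • U (lam ^ m • x) = 0 ∧
      (fun i j => (lam ^ m) ^ (4 / 3 : ℝ) * R (lam ^ m • x) i j) =
        fun i j => if i = j then c * (lam ^ m) ^ (4 / 3 : ℝ) else 0) ∧
    ContDiffOn ℝ ∞ (fun x => (lam ^ m) ^ (2 / 3 : ℝ) • U (lam ^ m • x))
      {x : EuclideanSpace ℝ (Fin 3) | r₀ / lam ^ m < ‖x‖} ∧
    ContDiffOn ℝ ∞ (fun x i j => (lam ^ m) ^ (4 / 3 : ℝ) * R (lam ^ m • x) i j)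
      {x : EuclideanSpace ℝ (Fin 3) | r₀ / lam ^ m < ‖x‖} ∧
    (∀ x : EuclideanSpace ℝ (Fin 3), r₀ / lam ^ m < ‖x‖ →
      (Matrix.of fun i j => (lam ^ m) ^ (4 / 3 : ℝ) * R (lam ^ m • x) i j).PosDef) ∧
    (MemLp (fun x => (lam ^ m) ^ (2 / 3 : ℝ) • U (lam ^ m • x)) 2 volume ∧
      IntegrableOn (fun x i j => (lam ^ m) ^ (4 / 3 : ℝ) * R (lam ^ m • x) i j)
        (ball (0 : EuclideanSpace ℝ (Fin 3)) (r₁ / lam ^ m)) volume) ∧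
    (∀ θ : EuclideanSpace ℝ (Fin 3) → ℝ, ContDiff ℝ ∞ θ → HasCompactSupport θ →
      ∫ x, ⟪(lam ^ m) ^ (2 / 3 : ℝ) • U (lam ^ m • x), gradient θ x⟫ = 0) ∧
    (∀ w : EuclideanSpace ℝ (Fin 3) → EuclideanSpace ℝ (Fin 3),
      FunctionSpaces.IsTestFunctionOn ⟨{x : EuclideanSpace ℝ (Fin 3) | x ≠ 0}, isOpen_ne⟩ w →
      (∀ x, VectorCalculus.divergence w x = 0) →
      ∫ x, (⟪(lam ^ m) ^ (2 / 3 : ℝ) • U (lam ^ m • x),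
          fderiv ℝ w x ((lam ^ m) ^ (2 / 3 : ℝ) • U (lam ^ m • x))⟫ +
        ∑ i, ∑ j, ((lam ^ m) ^ (4 / 3 : ℝ) * R (lam ^ m • x) i j) *
          fderiv ℝ w x (EuclideanSpace.single j 1) i) = 0) := by
  obtain ⟨hr₀, hr₀₁, hc⟩ := hr
  have hlam0 : 0 < lam := one_pos.trans hlam
  set μ : ℝ := lam ^ m with hμ
  have hμ0 : 0 < μ := pow_pos hlam0 m
  have hμ23 : 0 < μ ^ (2 / 3 : ℝ) := Real.rpow_pos_of_pos hμ0 _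
  have hμ43 : 0 < μ ^ (4 / 3 : ℝ) := Real.rpow_pos_of_pos hμ0 _
  have hnorm : ∀ x : EuclideanSpace ℝ (Fin 3), ‖μ • x‖ = μ * ‖x‖ := fun x => by
    rw [norm_smul, Real.norm_of_nonneg hμ0.le]
  have hsq : (μ ^ (2 / 3 : ℝ)) ^ 2 = μ ^ (4 / 3 : ℝ) := by
    rw [← Real.rpow_natCast, ← Real.rpow_mul hμ0.le]
    norm_num
  refine ⟨⟨div_pos hr₀ hμ0, div_lt_div_of_pos_right hr₀₁ hμ0, mul_pos hc hμ43⟩,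
    fun x hx0 hx => ?_, fun x hx => ?_, fun x hx => ?_, ?_, ?_, fun x hx => ?_, ⟨?_, ?_⟩,
    fun θ hθ hθc => integral_inner_smul_comp_smul_gradient_eq_zero hwdiv _ hμ0.ne' θ hθ hθc,
    fun w hw hdw => integral_eulerReynolds_comp_smul_eq_zero hweak _ _ hsq hμ0 w hw hdw⟩
  · -- the germ is unchanged
    have hx0' : x ≠ 0 := norm_pos_iff.1 hx0
    have h1 : 0 < ‖μ • x‖ := by rw [hnorm]; positivity
    have h2 : ‖μ • x‖ < r₀ := by rw [hnorm]; rwa [lt_div_iff₀' hμ0] at hx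
    rw [hgerm _ h1 h2, hμ, apply_pow_smul_of_dss hlam0 hDSS m x hx0', smul_smul, ← hμ,
      Real.rpow_neg hμ0.le, mul_inv_cancel₀ hμ23.ne', one_smul]
  · -- the stress vanishes on the closed germ ball
    have h2 : ‖μ • x‖ ≤ r₀ := by rw [hnorm]; rwa [le_div_iff₀' hμ0] at hx
    funext i j
    simp [hR0 _ h2]
  · -- the rest state outside
    have h2 : r₁ ≤ ‖μ • x‖ := by rw [hnorm]; rwa [div_le_iff₀' hμ0] at hx
    obtain ⟨hU0, hRc⟩ := hrest _ h2
    refine ⟨by rw [hU0, smul_zero], ?_⟩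
    funext i j
    rw [hRc]
    by_cases hij : i = j <;> simp [hij, mul_comm]
  · -- smoothness of the velocity on the collar
    refine ContDiffOn.const_smul _ (hUs.comp (contDiff_const_smul μ).contDiffOn fun x hx => ?_)
    simp only [mem_setOf_eq] at hx ⊢
    rw [hnorm]
    rwa [div_lt_iff₀' hμ0] at hx
  · -- smoothness of the stress on the collar
    have hmaps : MapsTo (fun x : EuclideanSpace ℝ (Fin 3) => μ • x)
        {x : EuclideanSpace ℝ (Fin 3) | r₀ / lam ^ m < ‖x‖}
        {x : EuclideanSpace ℝ (Fin 3) | r₀ < ‖x‖} := fun x hx => by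
      simp only [mem_setOf_eq] at hx ⊢
      rw [hnorm]
      rwa [div_lt_iff₀' hμ0] at hx
    exact ContDiffOn.const_smul (s := {x : EuclideanSpace ℝ (Fin 3) | r₀ / lam ^ m < ‖x‖})
      (μ ^ (4 / 3 : ℝ)) (hRs.comp (contDiff_const_smul μ).contDiffOn hmaps)
  · -- positivity on the collar
    have h2 : r₀ < ‖μ • x‖ := by rw [hnorm]; rwa [div_lt_iff₀' hμ0] at hx
    exact posDef_of_mul (hpos _ h2) hμ43
  · -- square integrability
    exact (memLp_comp_smul_aux hint.1 hμ0.ne').const_smul (μ ^ (2 / 3 : ℝ))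
  · -- integrability of the stress on the ball
    exact (integrableOn_comp_smul_ball hint.2 hμ0).smul (μ ^ (4 / 3 : ℝ))

end R3

end Literature.Analysis.FluidPDE
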